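import Mathlib.Data.Nat.Choose.Bounds
import Summits.ValiantsHypothesis.ValiantsHypothesis.Theorems.LacunarySymmetroidMatrixDescartesCensusTropicalKLawSlopes

/-!
# Route `KPlusLogSqLaw`, crux `TropicalB` — partial ranges of the thin stub from the small-`K` end

HONEST FRAMING.  Helper file for the crux `Summit.ValiantsHypothesis.ValiantsHypothesis.Theses.KPlusLogSqLaw.TropicalB`
(ledger item `stmt-ValiantsHypothesis-19771`, route `KPlusLogSqLaw`, DRAFT; cell `pub-symmetroid`, seat `val-sym-trop-p1`,
2026-08-26).  The registered stub `stub_tropThin` of `Cruxes/TropicalB/Lines/birth.lean` reads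
`∃ C, ∀ m K, K ≤ (Nat.log 2 m)^2 → TropRow m K (2 ^ (C * (Nat.log 2 m)^2))` (`TropRow ≡ TropicalCensus.TropRootLawAt`,
`Iff.rfl`).  This file does NOT prove it.  It lands, sorry-free, the part of the thin regime that COUNTING decides, in
the tree's vocabulary `TropicalCensus.TropRootLawAt m K B` ("every tropical design of format `(m, K)` has at most `B`
sign-alternating dominant breakpoints"), so that the undecided window is pinned in the kernel:

* `tropRootLawAt_two_pow`      — `TropRootLawAt m K (2 ^ (K + m - 1))` (slope counting `C(K+m-1, m) - 1 < 2^(K+m-1)`).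
* `tropRootLawAt_window`       — the CRUDE-COUNTING WINDOW LEMMA: `K + m ≤ C·(K + L²) + 1 → TropRootLawAt m K (2^(C·(K+L²)))`
  (`L = Nat.log 2 m`); equivalently (`tropRootLawAt_window'`, `1 ≤ C`) `m ≤ (C-1)·K + C·L² + 1`.  So for each fixed `C`
  the formats left undecided by counting are exactly `m > (C-1)·K + C·L² + 1` (deep window, `K = o(m)`).
* `tropRootLawAt_thinLinear`   — the LINEAR-THIN RANGE: `K ≤ A·L + 1 → TropRootLawAt m K (2 ^ ((A·A + 2·A) · L²))` for
  every `A : ℕ` (`A = 1` is the tree's `tropRootLawAt_thinEnd`); packaged in the stub's own shape as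
  `tropThin_linearRange : ∀ A, ∃ C, ∀ m K, K ≤ A·L + 1 → TropRootLawAt m K (2 ^ (C·L²))` — i.e. `stub_tropThin` holds on
  every strip `K ≤ A·log₂ m + 1` with a constant depending on `A`; the stub itself asks for ONE constant up to `K ≤ log₂² m`,
  where counting gives only `≈ L³` bits.  Nothing here enters that strip.
* `chain_le_mul_spread`        — the tropical DEGREE BOUND: a sign-alternating dominant chain of a design whose exponents lie
  in `[D₀, D₁]` has at most `m·(D₁ - D₀)` breakpoints (slopes are integers in `[m·D₀, m·D₁]` and strictly increase).  Hence all
  content of the stub sits at LACUNARY exponent vectors (`d_max - d_min > 2^(C·L²)/m`).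

Nothing in this file asserts `TropicalB`, `KPlusLogSqLaw`, `MatrixDescartes` or anything about `VP ≠ VNP`.

References: slope counting = the tree's `TropicalCensus.tropRootLawAt_slopeCount` / `_choose` (module
`…CensusTropicalKLawSlopes`); the window bookkeeping is §2.2 / §3.1(b) of the cell's onboarding note (conjb-2 g3, 2026-08-26).
-/

set_option linter.dupNamespace false
set_option autoImplicit false

namespace Summit.ValiantsHypothesis.ValiantsHypothesis.Theorems.KPlusLogSqLaw

open Summit.ValiantsHypothesis.ValiantsHypothesis.Theorems.MatrixDescartes.Negative
open Summit.ValiantsHypothesis.ValiantsHypothesis.Theorems.LacunarySymmetroidMatrixDescartes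
open Summit.ValiantsHypothesis.ValiantsHypothesis.Theorems.LacunarySymmetroidMatrixDescartes.TropicalCensus
open scoped BigOperators
open Finset

/-! ## 1. Crude counting and the window lemma -/

/-- **Crude counting.**  Every tropical design of format `(m, K)` has fewer than `2^(K+m-1)` sign-alternating dominant
breakpoints: `T(m,K) ≤ C(K+m-1, m) - 1 ≤ 2^(K+m-1)`. [folklore] -/
theorem tropRootLawAt_two_pow (m K : ℕ) : TropRootLawAt m K (2 ^ (K + m - 1)) :=
  tropRootLawAt_mono ((Nat.sub_le _ _).trans (Nat.choose_le_two_pow _ _)) (tropRootLawAt_choose m K)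

/-- **Crude-counting window lemma.**  If `K + m ≤ C·(K + (log₂ m)²) + 1` then the tropical `K + log² m` law holds at the
format `(m, K)` with constant `C`, by counting alone.  For each fixed `C` the formats NOT covered are
`m > (C-1)·K + C·(log₂ m)² + 1`, the deep window. [folklore] -/
theorem tropRootLawAt_window (C m K : ℕ) (h : K + m ≤ C * (K + Nat.log 2 m ^ 2) + 1) :
    TropRootLawAt m K (2 ^ (C * (K + Nat.log 2 m ^ 2))) :=
  tropRootLawAt_mono (Nat.pow_le_pow_right (by norm_num) (by omega)) (tropRootLawAt_two_pow m K)

/-- The window lemma in the form `m ≤ (C-1)·K + C·(log₂ m)² + 1` (for `1 ≤ C`, so that `(C-1)·K + K = C·K`). [folklore] -/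
theorem tropRootLawAt_window' {C : ℕ} (hC : 1 ≤ C) (m K : ℕ)
    (h : m ≤ (C - 1) * K + C * Nat.log 2 m ^ 2 + 1) :
    TropRootLawAt m K (2 ^ (C * (K + Nat.log 2 m ^ 2))) := by
  apply tropRootLawAt_window
  obtain ⟨C', rfl⟩ := Nat.exists_eq_add_of_le hC
  have e : (1 + C' - 1) * K = C' * K := by rw [Nat.add_sub_cancel_left]
  rw [e] at h
  nlinarith [Nat.zero_le (C' * Nat.log 2 m ^ 2)]

/-! ## 2. The linear-thin range `K ≤ A·log₂ m + 1` -/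

/-- arithmetic: `A·L + m < 2^(L+1+A)` for `L = log₂ m`. [folklore] -/
theorem mul_log_add_lt_two_pow (A m : ℕ) :
    A * Nat.log 2 m + m < 2 ^ (Nat.log 2 m + 1 + A) := by
  set L := Nat.log 2 m with hL
  have hm : m < 2 ^ (L + 1) := hL ▸ Nat.lt_pow_succ_log_self (by norm_num) m
  have hLlt : L < 2 ^ L := Nat.lt_two_pow_self
  have hA : A < 2 ^ A := Nat.lt_two_pow_self
  have h2L : 2 ^ (L + 1) = 2 * 2 ^ L := by ring
  have hpow : 2 ^ (L + 1 + A) = 2 * 2 ^ L * 2 ^ A := by rw [pow_add, h2L]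
  rw [hpow]
  nlinarith [Nat.zero_le (2 ^ L), Nat.zero_le (2 ^ A), Nat.zero_le A]

/-- **Linear-thin range.**  If `K ≤ A·log₂ m + 1` then every tropical design of format `(m, K)` has at most
`2^((A² + 2A)·(log₂ m)²)` sign-alternating dominant breakpoints.  Proof: slope counting, `T ≤ C(K+m-1, K-1) - 1 ≤
(K+m-1)^(K-1) ≤ 2^((log₂ m + 1 + A)·(K-1))` and `(log₂ m + 1 + A)·A·log₂ m ≤ (A² + 2A)·(log₂ m)²`.  The case `A = 1` is the
tree's `tropRootLawAt_thinEnd`. [folklore] -/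
theorem tropRootLawAt_thinLinear (A : ℕ) {m K : ℕ} (hK : K ≤ A * Nat.log 2 m + 1) :
    TropRootLawAt m K (2 ^ ((A * A + 2 * A) * Nat.log 2 m ^ 2)) := by
  rcases Nat.eq_zero_or_pos K with rfl | hKpos
  · exact tropRootLawAt_zero m _
  set L := Nat.log 2 m with hL
  refine tropRootLawAt_mono ?_ (tropRootLawAt_choose m K)
  have hsymm : (K + m - 1).choose m = (K + m - 1).choose (K - 1) :=
    Nat.choose_symm_of_eq_add (by omega)
  have hbase : K + m - 1 < 2 ^ (L + 1 + A) := by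
    have h := mul_log_add_lt_two_pow A m
    rw [← hL] at h
    omega
  have hexp : (L + 1 + A) * (K - 1) ≤ (A * A + 2 * A) * L ^ 2 := by
    have h1 : K - 1 ≤ A * L := by omega
    have hLL : L ≤ L ^ 2 := by nlinarith [Nat.zero_le L]
    calc (L + 1 + A) * (K - 1) ≤ (L + 1 + A) * (A * L) := Nat.mul_le_mul_left _ h1
      _ = A * L ^ 2 + A * L + A * A * L := by ring
      _ ≤ A * L ^ 2 + A * L ^ 2 + A * A * L ^ 2 := by
          have := Nat.mul_le_mul_left A hLL
          have := Nat.mul_le_mul_left (A * A) hLL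
          omega
      _ = (A * A + 2 * A) * L ^ 2 := by ring
  calc (K + m - 1).choose m - 1 ≤ (K + m - 1).choose (K - 1) := by rw [← hsymm]; exact Nat.sub_le _ _
    _ ≤ (K + m - 1) ^ (K - 1) := Nat.choose_le_pow _ _
    _ ≤ (2 ^ (L + 1 + A)) ^ (K - 1) := Nat.pow_le_pow_left hbase.le _
    _ = 2 ^ ((L + 1 + A) * (K - 1)) := by rw [← pow_mul]
    _ ≤ 2 ^ ((A * A + 2 * A) * L ^ 2) := Nat.pow_le_pow_right (by norm_num) hexp

/-- **The thin stub on every linear strip.**  For every `A` there is a constant `C` (namely `A² + 2A`) such that the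
registered stub `stub_tropThin` holds for all formats with `K ≤ A·log₂ m + 1`: in the stub's own shape,
`K ≤ A·log₂ m + 1 → TropRootLawAt m K (2 ^ (C·(log₂ m)²))`.  HONEST RANGE: the stub asks for ONE `C` on the whole thin
regime `K ≤ (log₂ m)²`; this covers only the strips of slope `A`, where counting suffices. [folklore] -/
theorem tropThin_linearRange (A : ℕ) :
    ∃ C : ℕ, ∀ m K : ℕ, K ≤ A * Nat.log 2 m + 1 → TropRootLawAt m K (2 ^ (C * Nat.log 2 m ^ 2)) :=
  ⟨A * A + 2 * A, fun _ _ hK => tropRootLawAt_thinLinear A hK⟩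

/-! ## 3. The tropical degree bound: all content is lacunary -/

/-- **Tropical degree bound.**  Along a sign-alternating chain of dominant terms of a design whose exponents all lie in
`[D₀, D₁]`, the number of breakpoints is at most `m·(D₁ - D₀)`: the slopes `Σᵢ d(λ i)` are integers in `[m·D₀, m·D₁]` and
strictly increase (`slope_lt_of_dominant`).  Twin of the real degree bound `#roots ≤ m·d_max`; so a design can only beat a
budget `B` if `d_max - d_min > B/m`, i.e. the thin stub's content sits at lacunary exponent vectors. [folklore] -/
theorem chain_le_mul_spread {m K : ℕ} (d : Fin K → ℕ) (v ε : Fin m → Fin m → Fin K → ℤ) {n : ℕ}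
    (θ : Fin (n + 1) → ℤ) (p : Fin (n + 1) → Equiv.Perm (Fin m) × (Fin m → Fin K))
    (hθ : StrictMono θ) (hdom : ∀ k, IsDominant d v ε (θ k) (p k))
    (halt : ∀ k : Fin n, termSign ε (p k.castSucc) * termSign ε (p k.succ) < 0)
    (D₀ D₁ : ℕ) (hd : ∀ l, D₀ ≤ d l ∧ d l ≤ D₁) : n ≤ m * (D₁ - D₀) := by
  -- consecutive terms are distinct (their signs multiply to a negative number)
  have hne : ∀ k : Fin n, p k.castSucc ≠ p k.succ := by
    intro k h
    have := halt k
    rw [h] at this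
    exact absurd this (not_lt.mpr (mul_self_nonneg _))
  -- slopes strictly increase
  have hsm : StrictMono fun k => TropicalCensus.slope d (p k) := by
    rw [Fin.strictMono_iff_lt_succ]
    intro k
    exact slope_lt_of_dominant d v ε (hθ Fin.castSucc_lt_succ) (hne k) (hdom _) (hdom _)
  -- slope bounds
  have hlo : ∀ k, (m : ℤ) * D₀ ≤ TropicalCensus.slope d (p k) := by
    intro k
    unfold TropicalCensus.slope
    calc (m : ℤ) * D₀ = ∑ _i : Fin m, (D₀ : ℤ) := by
          rw [sum_const, card_univ, Fintype.card_fin, nsmul_eq_mul]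
      _ ≤ ∑ i, (d ((p k).2 i) : ℤ) := sum_le_sum fun i _ => by exact_mod_cast (hd _).1
  have hhi : ∀ k, TropicalCensus.slope d (p k) ≤ (m : ℤ) * D₁ := by
    intro k
    unfold TropicalCensus.slope
    calc ∑ i, (d ((p k).2 i) : ℤ) ≤ ∑ _i : Fin m, (D₁ : ℤ) := sum_le_sum fun i _ => by exact_mod_cast (hd _).2
      _ = (m : ℤ) * D₁ := by rw [sum_const, card_univ, Fintype.card_fin, nsmul_eq_mul]
  -- a strictly increasing integer sequence gains at least 1 per step
  have hgain : ∀ k : Fin (n + 1), TropicalCensus.slope d (p 0) + (k : ℕ) ≤ TropicalCensus.slope d (p k) := by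
    intro k
    induction k using Fin.induction with
    | zero => simp
    | succ k ih =>
      have hlt : TropicalCensus.slope d (p k.castSucc) < TropicalCensus.slope d (p k.succ) := hsm Fin.castSucc_lt_succ
      have e : ((k.succ : ℕ) : ℤ) = (k.castSucc : ℕ) + 1 := by simp
      rw [e]
      have : TropicalCensus.slope d (p 0) + ((k.castSucc : ℕ) : ℤ) ≤ TropicalCensus.slope d (p k.castSucc) := ih
      linarith
  have hlast := hgain (Fin.last n)
  simp only [Fin.val_last] at hlast
  have h0 := hlo 0
  have hn := hhi (Fin.last n)
  -- so `n ≤ m·D₁ - m·D₀` over `ℤ`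
  have hint : (n : ℤ) ≤ (m : ℤ) * D₁ - (m : ℤ) * D₀ := by linarith
  rcases Nat.eq_zero_or_pos m with rfl | hm
  · simp at hint; omega
  · -- `Fin K` is nonempty once `m > 0` (the chain has a term), so `D₀ ≤ D₁`
    have hD : D₀ ≤ D₁ := by
      have l : Fin K := (p 0).2 ⟨0, hm⟩
      exact (hd l).1.trans (hd l).2
    have : ((m * (D₁ - D₀) : ℕ) : ℤ) = (m : ℤ) * D₁ - (m : ℤ) * D₀ := by
      rw [Nat.cast_mul, Nat.cast_sub hD]; ring
    omega

end Summit.ValiantsHypothesis.ValiantsHypothesis.Theorems.KPlusLogSqLaw
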